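import Summits.AtomisticToContinuum.HydrodynamicLimit.Theses.TwoClocks
import Literature.MathematicalPhysics.KineticTheory.HardSphereEulerLLN
import Literature.Analysis.FunctionSpaces.TorusSpaceTime

/-!
# The entropy clock `ClampedWindowDock` (stmt-AtomisticToContinuum-13735), I: time zero and the reference bookkeeping

Helpers for the (rev-4) dock `TwoClocks.ClampedWindowDock` (step (vii) of its informal proof). The "tie" of a triple
`(r, v, ϑ)` to the local Gibbs laws of `(a, w, ϑ')` is the Literature predicate
`TendstoHydroFieldsAt (fun N => localGibbsLaw σ a w ϑ' N (Φ N)) Φ (fun _ => r) (fun _ => v) (fun _ => ϑ) 0`.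
* `lawAt_zero_localGibbsLaw`, `klDiv_lawAt_zero_localGibbsLaw` — `lawAt Φ λ_N 0 = λ_N`, so `h_N(0) = 0`;
* `tie_of_expConc` — exponential concentration (the currency of `UniformLocalGibbsConcentration`) is a tie;
* `eq_of_tendsto_measure_lt_abs/_norm`, `eq_of_forall_integral_mul_eq`, `data_eq_of_ties` — uniqueness of
  limits in probability and DATA PINNING of tied triples;
* `timeZero_slice` — the `t = 0` clause of the consequent of `RelEntropyVanishing` with `a = a₀`;
* `relEntropyDock_of_core` (deprecated rev-4 name `clampedWindowDock_of_core`) — REDUCTION of the entropy-target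
  dock to its positive-time core (probability clause, `t = 0` slice, choice of `σ₀`, concentration of the reference).
prover-pitem-stmt-AtomisticToContinuum-13735-0.  MAINTENANCE RECORD (full-build repair 2026-08-17): route rev 10
(2026-08-16T20:17Z) DROPPED `ClampedWindowDock` (stmt-13735) and REPLACED its collisional pair
`EquilibriumClampedCollisionalWindowLD` (stmt-13733, refuted in Lean) / `CollisionActivityTails` (stmt-13734) by
`ClampedTransferWindowLD` (stmt-16623) / `TransferActivityTails` (stmt-16624); the reduction is transcribed verbatim over
the repaired pair (its proof never inspects the pair), the dock being spelled out as the chain to `RelEntropyVanishing`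
(= hypothesis `hD` of `assembly_of_relEntropyDock`, `TwoClocksAssembly.lean`).
-/

noncomputable section

namespace Summit.AtomisticToContinuum.HydrodynamicLimit.Theorems.EntropyClockDock

open MeasureTheory Filter Set Topology InformationTheory
open scoped ENNReal
open Literature.MathematicalPhysics.KineticTheory Literature.Analysis.FluidPDE

/-! ### §1 Time zero: the law and its relative entropy -/
/-- **At time `0` the law of the hard-sphere system is its initial local Gibbs law**:
`lawAt Φ λ_N 0 = λ_N` (`Φ₀ = id` on the good set, which carries the law). [folklore] -/
theorem lawAt_zero_localGibbsLaw (σ : ℝ) (a₀ : T3 → ℝ) (u₀ : T3 → V3) (θ₀ : T3 → ℝ) (N : ℕ)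
    (Φ : HardSphereFlow (Torus.geometry (Fin 3)) (hsDiameter σ N) (N + 1)) :
    Φ.lawAt (localGibbsLaw σ a₀ u₀ θ₀ N Φ) 0 = localGibbsLaw σ a₀ u₀ θ₀ N Φ := by
  rw [HardSphereFlow.lawAt_eq]
  have hac : localGibbsLaw σ a₀ u₀ θ₀ N Φ ≪ liouville (Torus.geometry (Fin 3)) (N + 1) (hsDiameter σ N) := by
    rw [localGibbsLaw, particleLaw_eq]; exact withDensity_absolutelyContinuous _ _
  have hae : Φ.flow 0 =ᵐ[localGibbsLaw σ a₀ u₀ θ₀ N Φ] id := by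
    filter_upwards [hac.ae_le Φ.ae_mem_good] with z hz
    exact Φ.flow_zero z hz
  rw [Measure.map_congr hae, Measure.map_id]

/-- **`h_N(0) = 0`**: the relative entropy of the time-`0` law with respect to the initial local Gibbs law
vanishes (continuous positive profiles, `σ ≤ 1/2`, so that the law is a probability measure). [folklore] -/
theorem klDiv_lawAt_zero_localGibbsLaw {σ : ℝ} (hσ2 : σ ≤ 1 / 2) {a₀ θ₀ : T3 → ℝ} {u₀ : T3 → V3}
    (ha : Continuous a₀) (hθ : Continuous θ₀) (hu : Continuous u₀) (ha0 : ∀ x, 0 < a₀ x)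
    (hθ0 : ∀ x, 0 < θ₀ x) (N : ℕ) (Φ : HardSphereFlow (Torus.geometry (Fin 3)) (hsDiameter σ N) (N + 1)) :
    klDiv (Φ.lawAt (localGibbsLaw σ a₀ u₀ θ₀ N Φ) 0) (localGibbsLaw σ a₀ u₀ θ₀ N Φ) = 0 := by
  haveI := isProbabilityMeasure_localGibbsLaw ha hθ hu ha0 hθ0 hσ2 N Φ
  rw [lawAt_zero_localGibbsLaw]
  exact klDiv_self _

/-- Through the flow at time `0`, events of the local Gibbs law are events of the configuration itself
(`Φ₀ = id` almost surely). [folklore] -/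
theorem localGibbsLaw_setOf_flow_zero (σ : ℝ) (a₀ : T3 → ℝ) (u₀ : T3 → V3) (θ₀ : T3 → ℝ) (N : ℕ)
    (Φ : HardSphereFlow (Torus.geometry (Fin 3)) (hsDiameter σ N) (N + 1))
    (p : Config (N + 1) (Fin 3) T3 → Prop) :
    localGibbsLaw σ a₀ u₀ θ₀ N Φ {z | p (Φ.flow 0 z)} = localGibbsLaw σ a₀ u₀ θ₀ N Φ {z | p z} := by
  rw [show {z | p (Φ.flow 0 z)} = Φ.flow 0 ⁻¹' {z | p z} from rfl, localGibbsLaw_preimage_flow_zero,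
    localGibbsLaw_eq]

/-! ### §2 Exponential concentration is a tie; uniqueness of limits in probability; data pinning -/
/-- A sequence in `ℝ≥0∞` dominated by `C e^{-(N+1)/C}` tends to `0`. [folklore] -/
theorem tendsto_zero_of_le_expConc {s : ℕ → ℝ≥0∞} {C : ℝ}
    (h : ∀ N : ℕ, s N ≤ ENNReal.ofReal (C * Real.exp (-(C⁻¹ * ((N : ℝ) + 1))))) (hC : 0 < C) :
    Tendsto s atTop (𝓝 0) := by
  have h1 : Tendsto (fun N : ℕ => C⁻¹ * ((N : ℝ) + 1)) atTop atTop :=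
    (tendsto_atTop_add_const_right _ 1 tendsto_natCast_atTop_atTop).const_mul_atTop (inv_pos.2 hC)
  have h2 : Tendsto (fun N : ℕ => C * Real.exp (-(C⁻¹ * ((N : ℝ) + 1)))) atTop (𝓝 (C * 0)) :=
    (Real.tendsto_exp_atBot.comp (tendsto_neg_atTop_atBot.comp h1)).const_mul C
  rw [mul_zero] at h2
  have h3 : Tendsto (fun N : ℕ => ENNReal.ofReal (C * Real.exp (-(C⁻¹ * ((N : ℝ) + 1))))) atTop (𝓝 0) := by
    simpa using ENNReal.tendsto_ofReal h2
  exact tendsto_of_tendsto_of_tendsto_of_le_of_le tendsto_const_nhds h3 (fun _ => bot_le) h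

/-- **Exponential concentration of the three empirical fields (the currency of
`UniformLocalGibbsConcentration`) is a tie**: the local Gibbs laws of `(a, w, ϑ)` are tied at time `0`, through
any flow family, to the constant-in-time fields `(ρ₀, w, ϑ)`. [folklore] -/
theorem tie_of_expConc {σ : ℝ} {a ϑ ρ₀ : T3 → ℝ} {w : T3 → V3}
    (Φ : (N : ℕ) → HardSphereFlow (Torus.geometry (Fin 3)) (hsDiameter σ N) (N + 1))
    (h : ∀ χ : T3 → ℝ, Continuous χ → ∀ δ : ℝ, 0 < δ → ∃ C : ℝ, 0 < C ∧
      ∀ (N : ℕ) (Ψ : HardSphereFlow (Torus.geometry (Fin 3)) (hsDiameter σ N) (N + 1)),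
        localGibbsLaw σ a w ϑ N Ψ {z | δ < |empiricalDensityField z χ - ∫ x, χ x * ρ₀ x|} ≤
            ENNReal.ofReal (C * Real.exp (-(C⁻¹ * ((N : ℝ) + 1)))) ∧
          localGibbsLaw σ a w ϑ N Ψ {z | δ < ‖empiricalMomentumField z χ - ∫ x, (χ x * ρ₀ x) • w x‖} ≤
            ENNReal.ofReal (C * Real.exp (-(C⁻¹ * ((N : ℝ) + 1)))) ∧
          localGibbsLaw σ a w ϑ N Ψ {z | δ < |empiricalEnergyField z χ -
              ∫ x, χ x * totalEnergyDensity (ρ₀ x) (w x) (ϑ x)|} ≤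
            ENNReal.ofReal (C * Real.exp (-(C⁻¹ * ((N : ℝ) + 1))))) :
    TendstoHydroFieldsAt (fun N => localGibbsLaw σ a w ϑ N (Φ N)) Φ (fun _ => ρ₀) (fun _ => w)
      (fun _ => ϑ) 0 := by
  intro χ hχ δ hδ
  obtain ⟨C, hC, hN⟩ := h χ hχ δ hδ
  refine ⟨tendsto_zero_of_le_expConc (fun N => ?_) hC, tendsto_zero_of_le_expConc (fun N => ?_) hC,
    tendsto_zero_of_le_expConc (fun N => ?_) hC⟩
  · rw [localGibbsLaw_setOf_flow_zero σ a w ϑ N (Φ N)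
      fun z => δ < |empiricalDensityField z χ - ∫ x, χ x * ρ₀ x|]
    exact (hN N (Φ N)).1
  · rw [localGibbsLaw_setOf_flow_zero σ a w ϑ N (Φ N)
      fun z => δ < ‖empiricalMomentumField z χ - ∫ x, (χ x * ρ₀ x) • w x‖]
    exact (hN N (Φ N)).2.1
  · rw [localGibbsLaw_setOf_flow_zero σ a w ϑ N (Φ N)
      fun z => δ < |empiricalEnergyField z χ - ∫ x, χ x * totalEnergyDensity (ρ₀ x) (w x) (ϑ x)|]
    exact (hN N (Φ N)).2.2

-- the next four lemmas are PRIVATE re-proofs of lemmas of the negative files of route ImplosionDichotomy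
-- (`DenseExcursionAtTimeZero.eq_of_tendsto_measure_lt_abs`, `.eq_of_forall_integral_mul_eq`,
-- `PolynomialCompressionPDE.eq_of_tendsto_measure_lt`, `.integral_apply_coord`), kept local so that this file does not
-- import another route's Theses module
/-- Limits in probability are unique (eventually-probability laws, real observables). [folklore] -/
private theorem eq_of_tendsto_measure_lt_abs {Ω : ℕ → Type*} [∀ N, MeasurableSpace (Ω N)]
    {P : (N : ℕ) → Measure (Ω N)} (hP : ∀ᶠ N in atTop, IsProbabilityMeasure (P N))
    {F : (N : ℕ) → Ω N → ℝ} {a b : ℝ}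
    (ha : ∀ δ > (0 : ℝ), Tendsto (fun N => P N {z | δ < |F N z - a|}) atTop (𝓝 0))
    (hb : ∀ δ > (0 : ℝ), Tendsto (fun N => P N {z | δ < |F N z - b|}) atTop (𝓝 0)) : a = b := by
  by_contra hab
  have hd : 0 < |a - b| := abs_pos.2 (sub_ne_zero.2 hab)
  set δ := |a - b| / 3 with hδ
  have hδ0 : 0 < δ := by positivity
  have hcover : ∀ N, (univ : Set (Ω N)) ⊆ {z | δ < |F N z - a|} ∪ {z | δ < |F N z - b|} := by
    intro N z _
    by_contra hz
    simp only [Set.mem_union, Set.mem_setOf_eq, not_or, not_lt] at hz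
    have : |a - b| ≤ |F N z - a| + |F N z - b| := by
      calc |a - b| = |(F N z - b) - (F N z - a)| := by congr 1; ring
        _ ≤ |F N z - b| + |F N z - a| := abs_sub _ _
        _ = |F N z - a| + |F N z - b| := add_comm _ _
    linarith [hz.1, hz.2]
  have hle : ∀ᶠ N in atTop, (1 : ℝ≥0∞) ≤ P N {z | δ < |F N z - a|} + P N {z | δ < |F N z - b|} := by
    filter_upwards [hP] with N hPN
    calc (1 : ℝ≥0∞) = P N univ := measure_univ.symm
      _ ≤ P N ({z | δ < |F N z - a|} ∪ {z | δ < |F N z - b|}) := measure_mono (hcover N)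
      _ ≤ _ := measure_union_le _ _
  have hlim : Tendsto (fun N => P N {z | δ < |F N z - a|} + P N {z | δ < |F N z - b|}) atTop (𝓝 0) := by
    simpa using (ha δ hδ0).add (hb δ hδ0)
  exact absurd (ge_of_tendsto hlim hle) (by simp)

/-- Limits in probability are unique (observables in a normed group). [folklore] -/
private theorem eq_of_tendsto_measure_lt_norm {Ω : ℕ → Type*} [∀ N, MeasurableSpace (Ω N)]
    {P : (N : ℕ) → Measure (Ω N)} (hP : ∀ᶠ N in atTop, IsProbabilityMeasure (P N))
    {E : Type*} [NormedAddCommGroup E] {F : (N : ℕ) → Ω N → E} {a b : E}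
    (ha : ∀ δ > (0 : ℝ), Tendsto (fun N => P N {z | δ < ‖F N z - a‖}) atTop (𝓝 0))
    (hb : ∀ δ > (0 : ℝ), Tendsto (fun N => P N {z | δ < ‖F N z - b‖}) atTop (𝓝 0)) : a = b := by
  by_contra hab
  have hd : 0 < ‖a - b‖ := norm_pos_iff.2 (sub_ne_zero.2 hab)
  set δ := ‖a - b‖ / 3 with hδ
  have hδ0 : 0 < δ := by positivity
  have hcover : ∀ N, (univ : Set (Ω N)) ⊆ {z | δ < ‖F N z - a‖} ∪ {z | δ < ‖F N z - b‖} := by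
    intro N z _
    by_contra hz
    simp only [Set.mem_union, Set.mem_setOf_eq, not_or, not_lt] at hz
    have : ‖a - b‖ ≤ ‖F N z - a‖ + ‖F N z - b‖ := by
      calc ‖a - b‖ = ‖(F N z - b) - (F N z - a)‖ := by congr 1; abel
        _ ≤ ‖F N z - b‖ + ‖F N z - a‖ := norm_sub_le _ _
        _ = ‖F N z - a‖ + ‖F N z - b‖ := add_comm _ _
    linarith [hz.1, hz.2]
  have hle : ∀ᶠ N in atTop, (1 : ℝ≥0∞) ≤ P N {z | δ < ‖F N z - a‖} + P N {z | δ < ‖F N z - b‖} := by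
    filter_upwards [hP] with N hPN
    calc (1 : ℝ≥0∞) = P N univ := measure_univ.symm
      _ ≤ P N ({z | δ < ‖F N z - a‖} ∪ {z | δ < ‖F N z - b‖}) := measure_mono (hcover N)
      _ ≤ _ := measure_union_le _ _
  have hlim : Tendsto (fun N => P N {z | δ < ‖F N z - a‖} + P N {z | δ < ‖F N z - b‖}) atTop (𝓝 0) := by
    simpa using (ha δ hδ0).add (hb δ hδ0)
  exact absurd (ge_of_tendsto hlim hle) (by simp)

/-- Two continuous functions on `𝕋³` with equal integrals against every continuous test function are equal.
[folklore] -/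
private theorem eq_of_forall_integral_mul_eq {f g : T3 → ℝ} (hf : Continuous f) (hg : Continuous g)
    (h : ∀ χ : T3 → ℝ, Continuous χ → ∫ x, χ x * f x = ∫ x, χ x * g x) : f = g := by
  have hw : Continuous fun x => f x - g x := hf.sub hg
  have hint : ∫ x, (f x - g x) ^ 2 = 0 := by
    have hi1 : Integrable (fun x => (f x - g x) * f x) := integrable_of_continuous_T3 (hw.mul hf)
    have hi2 : Integrable (fun x => (f x - g x) * g x) := integrable_of_continuous_T3 (hw.mul hg)
    have h2 : ∫ x, ((f x - g x) * f x - (f x - g x) * g x) = 0 := by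
      rw [integral_sub hi1 hi2, h _ hw, sub_self]
    have e : (fun x => (f x - g x) ^ 2) = fun x => (f x - g x) * f x - (f x - g x) * g x := by
      funext x; ring
    rw [e]
    exact h2
  have hae : (fun x => (f x - g x) ^ 2) =ᵐ[volume] 0 :=
    (integral_eq_zero_iff_of_nonneg (fun x => sq_nonneg (f x - g x))
      (integrable_of_continuous_T3 (hw.pow 2))).1 hint
  have heq : (fun x => (f x - g x) ^ 2) = 0 :=
    (Continuous.ae_eq_iff_eq volume (hw.pow 2) continuous_const).1 hae
  funext x
  have hx := congrFun heq x
  simp only [Pi.zero_apply, ne_eq, OfNat.ofNat_ne_zero, not_false_eq_true, pow_eq_zero_iff] at hx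
  linarith

/-- Coordinates of a Bochner integral of a `V3`-valued function on `𝕋³`. [folklore] -/
private theorem integral_apply_coord {F : T3 → V3} (hF : Integrable F volume) (i : Fin 3) :
    (∫ x, F x) i = ∫ x, F x i :=
  ((EuclideanSpace.proj i : V3 →L[ℝ] ℝ).integral_comp_comm hF).symm

-- adapted from `PolynomialCompressionPDE.data_eq_of_flowFree` (route ImplosionDichotomy's negative file), in the
-- currency of `TendstoHydroFieldsAt` through a flow family
/-- **DATA PINNING.** At `σ ≤ 1/2`, if the local Gibbs laws of the continuous positive profiles `(a, w, ϑ)` are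
tied to the constant-in-time triple `(ρ₀, w, ϑ)` with `ρ₀` continuous and positive, then every field triple
`(ρ, u, θ)` with continuous time-`0` slices tied to the same laws has `(ρ 0, u 0, θ 0) = (ρ₀, w, ϑ)` (uniqueness
of limits in probability, field by field; momentum coordinatewise; `ρ₀ > 0` to divide). [folklore] -/
theorem data_eq_of_ties {σ : ℝ} (hσ2 : σ ≤ 1 / 2) {a ϑ ρ₀ : T3 → ℝ} {w : T3 → V3}
    (Φ : (N : ℕ) → HardSphereFlow (Torus.geometry (Fin 3)) (hsDiameter σ N) (N + 1))
    (ha : Continuous a) (hϑ : Continuous ϑ) (hw : Continuous w) (ha0 : ∀ x, 0 < a x) (hϑ0 : ∀ x, 0 < ϑ x)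
    (hρ₀c : Continuous ρ₀) (hρ₀pos : ∀ x, 0 < ρ₀ x)
    (hlln : TendstoHydroFieldsAt (fun N => localGibbsLaw σ a w ϑ N (Φ N)) Φ (fun _ => ρ₀) (fun _ => w)
      (fun _ => ϑ) 0)
    {ρ θ : ℝ → T3 → ℝ} {u : ℝ → T3 → V3} (hrc : Continuous (ρ 0)) (hvc : Continuous (u 0))
    (hηc : Continuous (θ 0))
    (ht : TendstoHydroFieldsAt (fun N => localGibbsLaw σ a w ϑ N (Φ N)) Φ ρ u θ 0) :
    ρ 0 = ρ₀ ∧ u 0 = w ∧ θ 0 = ϑ := by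
  have hP : ∀ᶠ N in atTop, IsProbabilityMeasure (localGibbsLaw σ a w ϑ N (Φ N)) :=
    Eventually.of_forall fun N => isProbabilityMeasure_localGibbsLaw ha hϑ hw ha0 hϑ0 hσ2 N (Φ N)
  -- density
  have hρ : ρ 0 = ρ₀ := by
    refine eq_of_forall_integral_mul_eq hrc hρ₀c fun χ hχ => ?_
    exact eq_of_tendsto_measure_lt_abs (F := fun N z => empiricalDensityField ((Φ N).flow 0 z) χ) hP
      (fun δ hδ => (ht χ hχ δ hδ).1) (fun δ hδ => (hlln χ hχ δ hδ).1)
  -- momentum, coordinatewise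
  have hu' : u 0 = w := by
    have hvec : ∀ χ : T3 → ℝ, Continuous χ → ∫ x, (χ x * ρ₀ x) • u 0 x = ∫ x, (χ x * ρ₀ x) • w x := by
      intro χ hχ
      have e := eq_of_tendsto_measure_lt_norm (E := V3)
        (F := fun N z => empiricalMomentumField ((Φ N).flow 0 z) χ) hP
        (fun δ hδ => (ht χ hχ δ hδ).2.1) (fun δ hδ => (hlln χ hχ δ hδ).2.1)
      rw [hρ] at e
      exact e
    have hcoord : ∀ i : Fin 3, (fun x => ρ₀ x * u 0 x i) = fun x => ρ₀ x * w x i := by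
      intro i
      refine eq_of_forall_integral_mul_eq (hρ₀c.mul ((EuclideanSpace.proj i : V3 →L[ℝ] ℝ).continuous.comp hvc))
        (hρ₀c.mul ((EuclideanSpace.proj i : V3 →L[ℝ] ℝ).continuous.comp hw)) fun χ hχ => ?_
      have e := congrArg (fun v : V3 => v i) (hvec χ hχ)
      simp only at e
      rw [integral_apply_coord (F := fun x => (χ x * ρ₀ x) • u 0 x)
          (integrable_of_continuous_T3 ((hχ.mul hρ₀c).smul hvc)),
        integral_apply_coord (F := fun x => (χ x * ρ₀ x) • w x)
          (integrable_of_continuous_T3 ((hχ.mul hρ₀c).smul hw))] at e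
      simp only [PiLp.smul_apply, smul_eq_mul] at e
      simpa only [mul_assoc] using e
    funext x
    ext i
    exact mul_left_cancel₀ (hρ₀pos x).ne' (congrFun (hcoord i) x)
  -- energy
  have hθ' : θ 0 = ϑ := by
    have hE : (fun x => totalEnergyDensity (ρ₀ x) (w x) (θ 0 x)) =
        fun x => totalEnergyDensity (ρ₀ x) (w x) (ϑ x) := by
      refine eq_of_forall_integral_mul_eq ?_ ?_ fun χ hχ => ?_
      · unfold totalEnergyDensity; fun_prop
      · unfold totalEnergyDensity; fun_prop
      · have e := eq_of_tendsto_measure_lt_abs (F := fun N z => empiricalEnergyField ((Φ N).flow 0 z) χ) hP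
          (fun δ hδ => (ht χ hχ δ hδ).2.2) (fun δ hδ => (hlln χ hχ δ hδ).2.2)
        rw [hρ, hu'] at e
        exact e
    funext x
    have hx := congrFun hE x
    unfold totalEnergyDensity at hx
    have := mul_left_cancel₀ (hρ₀pos x).ne' hx
    linarith
  exact ⟨hρ, hu', hθ'⟩

/-! ### §3 The `t = 0` slice of the consequent of `RelEntropyVanishing` -/
/-- **The entropy clock at time zero.** At `σ ≤ 1/2`, if the local Gibbs laws of `(a₀, u₀, θ₀)` concentrate
exponentially around `(ρ₀, ρ₀u₀, E(ρ₀,u₀,θ₀))`, every classical solution on `[0, T)`, `0 < T`, tied to them at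
`t = 0` through `Φ` satisfies the `t = 0` clause of `RelEntropyVanishing` with `a = a₀`: the data are pinned
(`data_eq_of_ties`), so the reference IS the initial law and `KL(lawAt Φ λ_N 0 ‖ λ_N) = 0`. [folklore] -/
theorem timeZero_slice {σ : ℝ} (hσ2 : σ ≤ 1 / 2) {a₀ θ₀ ρ₀ : T3 → ℝ} {u₀ : T3 → V3}
    (ha : Continuous a₀) (hθ : Continuous θ₀) (hu : Continuous u₀) (ha0 : ∀ x, 0 < a₀ x) (hθ0 : ∀ x, 0 < θ₀ x)
    (hρ₀c : Continuous ρ₀) (hρ₀pos : ∀ x, 0 < ρ₀ x)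
    (hconc : ∀ χ : T3 → ℝ, Continuous χ → ∀ δ : ℝ, 0 < δ → ∃ C : ℝ, 0 < C ∧
      ∀ (N : ℕ) (Ψ : HardSphereFlow (Torus.geometry (Fin 3)) (hsDiameter σ N) (N + 1)),
        localGibbsLaw σ a₀ u₀ θ₀ N Ψ {z | δ < |empiricalDensityField z χ - ∫ x, χ x * ρ₀ x|} ≤
            ENNReal.ofReal (C * Real.exp (-(C⁻¹ * ((N : ℝ) + 1)))) ∧
          localGibbsLaw σ a₀ u₀ θ₀ N Ψ {z | δ < ‖empiricalMomentumField z χ - ∫ x, (χ x * ρ₀ x) • u₀ x‖} ≤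
            ENNReal.ofReal (C * Real.exp (-(C⁻¹ * ((N : ℝ) + 1)))) ∧
          localGibbsLaw σ a₀ u₀ θ₀ N Ψ {z | δ < |empiricalEnergyField z χ -
              ∫ x, χ x * totalEnergyDensity (ρ₀ x) (u₀ x) (θ₀ x)|} ≤
            ENNReal.ofReal (C * Real.exp (-(C⁻¹ * ((N : ℝ) + 1)))))
    {T : ℝ} {ρ θ : ℝ → T3 → ℝ} {u : ℝ → T3 → V3} (hE : IsHardSphereEulerSolution σ T ρ u θ) (hT : 0 < T)
    (Φ : (N : ℕ) → HardSphereFlow (Torus.geometry (Fin 3)) (hsDiameter σ N) (N + 1))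
    (htie : TendstoHydroFieldsAt (fun N => localGibbsLaw σ a₀ u₀ θ₀ N (Φ N)) Φ ρ u θ 0) :
    ∃ a : T3 → ℝ, (∀ N, IsProbabilityMeasure (localGibbsLaw σ a (u 0) (θ 0) N (Φ N))) ∧
      (∀ χ : T3 → ℝ, Continuous χ → ∀ δ : ℝ, 0 < δ → ∃ C : ℝ, 0 < C ∧ ∀ N : ℕ,
        localGibbsLaw σ a (u 0) (θ 0) N (Φ N) {z | δ < |empiricalDensityField z χ - ∫ x, χ x * ρ 0 x|} ≤
            ENNReal.ofReal (C * Real.exp (-(C⁻¹ * ((N : ℝ) + 1)))) ∧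
          localGibbsLaw σ a (u 0) (θ 0) N (Φ N)
              {z | δ < ‖empiricalMomentumField z χ - ∫ x, (χ x * ρ 0 x) • u 0 x‖} ≤
            ENNReal.ofReal (C * Real.exp (-(C⁻¹ * ((N : ℝ) + 1)))) ∧
          localGibbsLaw σ a (u 0) (θ 0) N (Φ N) {z | δ < |empiricalEnergyField z χ -
              ∫ x, χ x * totalEnergyDensity (ρ 0 x) (u 0 x) (θ 0 x)|} ≤
            ENNReal.ofReal (C * Real.exp (-(C⁻¹ * ((N : ℝ) + 1))))) ∧
      Tendsto (fun N : ℕ => klDiv ((Φ N).lawAt (localGibbsLaw σ a₀ u₀ θ₀ N (Φ N)) 0)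
        (localGibbsLaw σ a (u 0) (θ 0) N (Φ N)) / ((N : ℝ≥0∞) + 1)) atTop (𝓝 0) := by
  have h0 : (0 : ℝ) ∈ Ico 0 T := ⟨le_rfl, hT⟩
  obtain ⟨hρ, hu', hθ'⟩ := data_eq_of_ties hσ2 Φ ha hθ hu ha0 hθ0 hρ₀c hρ₀pos (tie_of_expConc Φ hconc)
    (hE.smooth_density.isSmooth_slice h0).continuous (hE.smooth_velocity.isSmooth_slice h0).continuous
    (hE.smooth_temperature.isSmooth_slice h0).continuous htie
  refine ⟨a₀, fun N => ?_, fun χ hχ δ hδ => ?_, ?_⟩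
  · rw [hu', hθ']
    exact isProbabilityMeasure_localGibbsLaw ha hθ hu ha0 hθ0 hσ2 N (Φ N)
  · obtain ⟨C, hC, hN⟩ := hconc χ hχ δ hδ
    refine ⟨C, hC, fun N => ?_⟩
    rw [hρ, hu', hθ']
    exact hN N (Φ N)
  · simp only [hu', hθ', klDiv_lawAt_zero_localGibbsLaw hσ2 ha hθ hu ha0 hθ0, ENNReal.zero_div]
    exact tendsto_const_nhds

/-! ### §4 Reduction of the dock to its positive-time core -/
open Summit.AtomisticToContinuum.HydrodynamicLimit.Theses.TwoClocks in
/-- **The entropy-target dock (rev-4 `ClampedWindowDock`, transcribed over the rev-10 collisional pair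
`ClampedTransferWindowLD` / `TransferActivityTails`) reduces to its positive-time ENTROPY-CLOCK CORE.** Discharged here: the probability
clause (`σ ≤ 1/2`), the `t = 0` slice (`timeZero_slice`), the choice `σ₀ ≤ min(1/2, η₀∫a₀/sup a₀)`, and at
positive times the exponential concentration of the reference around the Euler fields (from the matrix of
`UniformLocalGibbsConcentration` at the produced activity, its anonymous LLN density being pinned to `ρ_t` by
`data_eq_of_ties`). What remains (`core`, with that matrix at a given `η₀` and the six other antecedents
available): for `t ∈ (0, T)` an `η₀`-dilute continuous positive activity `a_t` whose local Gibbs law with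
`(u_t, θ_t)` is TIED to the Euler fields, and `KL(lawAt Φ λ_N t ‖ localGibbsLaw σ a_t u_t θ_t)/(N+1) → 0`
(Yau's Gronwall, steps (i)–(vi) of the dock). [folklore] -/
theorem relEntropyDock_of_core
    (core : ∀ η₀ : ℝ, 0 < η₀ →
      (∀ (a θ₀ : T3 → ℝ) (u₀ : T3 → V3), Continuous a → Continuous θ₀ → Continuous u₀ → (∀ x, 0 < a x) →
        (∀ x, 0 < θ₀ x) → ∀ σ : ℝ, 0 < σ → σ ^ 3 * (⨆ x, a x) ≤ η₀ * ∫ x, a x →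
        ∃ ρ₀ : T3 → ℝ, Continuous ρ₀ ∧ (∀ x, 0 < ρ₀ x) ∧
          (∀ (N : ℕ) (Φ : HardSphereFlow (Torus.geometry (Fin 3)) (hsDiameter σ N) (N + 1)),
            IsProbabilityMeasure (localGibbsLaw σ a u₀ θ₀ N Φ)) ∧
          ∀ χ : T3 → ℝ, Continuous χ → ∀ δ : ℝ, 0 < δ → ∃ C : ℝ, 0 < C ∧
            ∀ (N : ℕ) (Φ : HardSphereFlow (Torus.geometry (Fin 3)) (hsDiameter σ N) (N + 1)),
              localGibbsLaw σ a u₀ θ₀ N Φ {z | δ < |empiricalDensityField z χ - ∫ x, χ x * ρ₀ x|} ≤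
                  ENNReal.ofReal (C * Real.exp (-(C⁻¹ * ((N : ℝ) + 1)))) ∧
                localGibbsLaw σ a u₀ θ₀ N Φ
                    {z | δ < ‖empiricalMomentumField z χ - ∫ x, (χ x * ρ₀ x) • u₀ x‖} ≤
                  ENNReal.ofReal (C * Real.exp (-(C⁻¹ * ((N : ℝ) + 1)))) ∧
                localGibbsLaw σ a u₀ θ₀ N Φ {z | δ < |empiricalEnergyField z χ -
                    ∫ x, χ x * totalEnergyDensity (ρ₀ x) (u₀ x) (θ₀ x)|} ≤
                  ENNReal.ofReal (C * Real.exp (-(C⁻¹ * ((N : ℝ) + 1))))) →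
      KineticWindowLDUniform → ClampedTransferWindowLD → TransferActivityTails →
      EnergyCurrentTails → HsEosLowDensity → DiluteSelfConsistency →
      ∀ (a₀ θ₀ : T3 → ℝ) (u₀ : T3 → V3), Continuous a₀ → Continuous θ₀ → Continuous u₀ →
        (∀ x, 0 < a₀ x) → (∀ x, 0 < θ₀ x) →
        ∃ σ₀ : ℝ, 0 < σ₀ ∧ ∀ σ : ℝ, 0 < σ → σ < σ₀ →
          ∀ (T : ℝ) (ρ θ : ℝ → T3 → ℝ) (u : ℝ → T3 → V3), IsHardSphereEulerSolution σ T ρ u θ →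
            ∀ Φ : (N : ℕ) → HardSphereFlow (Torus.geometry (Fin 3)) (hsDiameter σ N) (N + 1),
              TendstoHydroFieldsAt (fun N => localGibbsLaw σ a₀ u₀ θ₀ N (Φ N)) Φ ρ u θ 0 →
              ∀ t ∈ Set.Ioo 0 T, ∃ a : T3 → ℝ, Continuous a ∧ (∀ x, 0 < a x) ∧
                σ ^ 3 * (⨆ x, a x) ≤ η₀ * ∫ x, a x ∧
                TendstoHydroFieldsAt (fun N => localGibbsLaw σ a (u t) (θ t) N (Φ N)) Φ (fun _ => ρ t)
                  (fun _ => u t) (fun _ => θ t) 0 ∧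
                Tendsto (fun N : ℕ => klDiv ((Φ N).lawAt (localGibbsLaw σ a₀ u₀ θ₀ N (Φ N)) t)
                  (localGibbsLaw σ a (u t) (θ t) N (Φ N)) / ((N : ℝ≥0∞) + 1)) atTop (𝓝 0)) :
    KineticWindowLDUniform → ClampedTransferWindowLD → TransferActivityTails → EnergyCurrentTails →
      UniformLocalGibbsConcentration → HsEosLowDensity → DiluteSelfConsistency → RelEntropyVanishing := by
  intro hK h₃ h₇ h₆ hU hEos hS a₀ θ₀ u₀ ha hθ hu ha0 hθ0
  obtain ⟨η₀, hη₀, HU⟩ := hU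
  obtain ⟨σc, hσc, Hc⟩ := core η₀ hη₀ HU hK h₃ h₇ h₆ hEos hS a₀ θ₀ u₀ ha hθ hu ha0 hθ0
  -- the initial activity is `η₀`-dilute for `σ ≤ min (1/2) (η₀ ∫a₀ / sup a₀)`
  have hI : 0 < ∫ x, a₀ x := integral_pos_of_continuous_pos ha ha0
  have hbdd : BddAbove (Set.range a₀) := (isCompact_range ha).bddAbove
  have hSpos : 0 < ⨆ x, a₀ x := (ha0 0).trans_le (le_ciSup hbdd 0)
  have hg : 0 < η₀ * (∫ x, a₀ x) / ⨆ x, a₀ x := div_pos (mul_pos hη₀ hI) hSpos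
  refine ⟨min σc (min (1 / 2) (η₀ * (∫ x, a₀ x) / ⨆ x, a₀ x)),
    lt_min hσc (lt_min (by norm_num) hg), fun σ hσ hσlt T ρ θ u hE Φ => ?_⟩
  have hσc' : σ < σc := hσlt.trans_le (min_le_left _ _)
  have hσ2 : σ ≤ 1 / 2 := (hσlt.trans_le ((min_le_right _ _).trans (min_le_left _ _))).le
  have hσg : σ ≤ η₀ * (∫ x, a₀ x) / ⨆ x, a₀ x :=
    (hσlt.trans_le ((min_le_right _ _).trans (min_le_right _ _))).le
  have hguard : σ ^ 3 * (⨆ x, a₀ x) ≤ η₀ * ∫ x, a₀ x := by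
    have h31 : σ ^ 3 ≤ σ := pow_le_of_le_one hσ.le (hσ2.trans (by norm_num)) three_ne_zero
    calc σ ^ 3 * (⨆ x, a₀ x) ≤ σ * ⨆ x, a₀ x := mul_le_mul_of_nonneg_right h31 hSpos.le
      _ ≤ η₀ * (∫ x, a₀ x) / (⨆ x, a₀ x) * ⨆ x, a₀ x := mul_le_mul_of_nonneg_right hσg hSpos.le
      _ = η₀ * ∫ x, a₀ x := div_mul_cancel₀ _ hSpos.ne'
  refine ⟨fun N => isProbabilityMeasure_localGibbsLaw ha hθ hu ha0 hθ0 hσ2 N (Φ N), fun htie t ht => ?_⟩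
  obtain ⟨ρ₀, hρ₀c, hρ₀pos, -, hconc⟩ := HU a₀ θ₀ u₀ ha hθ hu ha0 hθ0 σ hσ hguard
  rcases ht.1.eq_or_lt with h0 | htpos
  · subst h0
    exact timeZero_slice hσ2 ha hθ hu ha0 hθ0 hρ₀c hρ₀pos hconc hE ht.2 Φ htie
  · obtain ⟨a, hac, hapos, haguard, hatie, hkl⟩ := Hc σ hσ hσc' T ρ θ u hE Φ htie t ⟨htpos, ht.2⟩
    have hρtc : Continuous (ρ t) := (hE.smooth_density.isSmooth_slice ht).continuous
    have hutc : Continuous (u t) := (hE.smooth_velocity.isSmooth_slice ht).continuous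
    have hθtc : Continuous (θ t) := (hE.smooth_temperature.isSmooth_slice ht).continuous
    have hθtpos : ∀ x, 0 < θ t x := hE.temperature_pos t ht
    obtain ⟨ρ₁, hρ₁c, hρ₁pos, hprob, hconc₁⟩ := HU a (θ t) (u t) hac hθtc hutc hapos hθtpos σ hσ haguard
    -- pin the anonymous LLN density `ρ₁` of the reference to the Euler density `ρ t`
    obtain ⟨hρt, -, -⟩ := data_eq_of_ties hσ2 Φ hac hθtc hutc hapos hθtpos hρ₁c hρ₁pos
      (tie_of_expConc Φ hconc₁) (ρ := fun _ => ρ t) (u := fun _ => u t) (θ := fun _ => θ t)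
      hρtc hutc hθtc hatie
    refine ⟨a, fun N => hprob N (Φ N), fun χ hχ δ hδ => ?_, hkl⟩
    obtain ⟨C, hC, hN⟩ := hconc₁ χ hχ δ hδ
    exact ⟨C, hC, fun N => by rw [hρt]; exact hN N (Φ N)⟩

/-- DEPRECATED rev-4 name (concluded the dropped route decl `ClampedWindowDock`, stmt-13735). [folklore] -/
@[deprecated relEntropyDock_of_core (since := "2026-08-17")]
alias clampedWindowDock_of_core := relEntropyDock_of_core

end Summit.AtomisticToContinuum.HydrodynamicLimit.Theorems.EntropyClockDock

end
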